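import Mathlib.RingTheory.PowerSeries.Basic
import HarnessLib

/-!
# The formal Euler product `∏_{n≥1} (1 − m qⁿ) ∈ R⟦q⟧` (definitions)
# (Silverman, *Advanced Topics*, Prop. V.3.2 (a): the building block `∏(1 − qⁿu)` of `θ(u,q)`)

Topic `Literature/NumberTheory/EllipticCurves/TateCurve`, namespace
`Literature.NumberTheory.EllipticCurves.TateCurve` (cell `bsd-eis`, seat `bsd-eis-k5-c4` g3; input
T1 of the discharge of `SteinWuthrich2013.exists_isSplitMultCanonical` via Silverman's theta
relation Prop. V.3.2 (b)(i) and the `q`-expansion transfer machine `PowerSeriesEval` /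
`LaurentSeriesIdentity2`).

To run the theta function `θ(u,q) = (1−u)∏(1−qⁿu)(1−qⁿu⁻¹)/(1−qⁿ)²` (Prop. V.3.2 (a); tree
`tateTheta q u = (1−u) P(u) P(u⁻¹)/P(1)²`, `P(v) = tateP q v = ∏'_{n} (1 − q^{n+1} v)`) through the
transfer machine one needs `P` as a FORMAL `q`-series with coefficients in a ring `R`
(`R = ℤ[u₁^{±1},u₂^{±1}]`, `m` a monomial). Definitions only (evaluation theorems:
`FormalEulerProduct.lean`):

* `eulerFin m N = ∏_{n<N} (1 − m q^{n+1}) ∈ R⟦q⟧`;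
* `eulerForm m ∈ R⟦q⟧`, `coeff d (eulerForm m) := coeff d (eulerFin m d)` (the coefficients of the
  finite products are stable from `N = d` on).

## References
* [SilvermanATAEC1994] J. H. Silverman, *Advanced Topics in the Arithmetic of Elliptic Curves*,
  GTM 151, Springer 1994, Prop. V.3.2 (a) (PDF p. 399).
-/

noncomputable section

open PowerSeries Finset

namespace Literature.NumberTheory.EllipticCurves.TateCurve

variable {R : Type*} [CommRing R]

/-- The finite Euler product `∏_{n<N} (1 − m q^{n+1}) ∈ R⟦q⟧`.
[cite: SilvermanATAEC1994, Prop. V.3.2 (a) (PDF p. 399)] -/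
def eulerFin (m : R) (N : ℕ) : PowerSeries R :=
  ∏ n ∈ range N, (1 - PowerSeries.C m * X ^ (n + 1))

/-- **The formal Euler product `∏_{n≥1} (1 − m qⁿ) ∈ R⟦q⟧`**: its `d`-th coefficient is that of
the finite product `∏_{n≤d}`, beyond which the coefficients are stable.
[cite: SilvermanATAEC1994, Prop. V.3.2 (a) (PDF p. 399)] -/
def eulerForm (m : R) : PowerSeries R :=
  PowerSeries.mk fun d => coeff d (eulerFin m d)

end Literature.NumberTheory.EllipticCurves.TateCurve

end
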